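import Summits.AtomisticToContinuum.FouriersLaw.Theorems.HiddenChargeMazurOpenMazurBridgeDressedPairing

/-!
# `HiddenChargeMazur.OpenMazurBridge`, part 2: the open-chain Mazur–Thomson bound for dressed test functions

Helper file (`--supports` stmt-AtomisticToContinuum-13513, route `HiddenChargeMazur`, sub-problem `FouriersLaw`,
summit `AtomisticToContinuum`). For `pinnedChain ω₂ lam β γ` (all parameters `> 0`), `T > 0`, `N ≥ 1`, under
weak-NESS uniqueness and for any steady-state family with response coefficient `D` at `(N, T)`:

* `integrable_mul_mul_gibbsDensity_of_abs_le_exp` — products of two observables of exponential classes with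
  `a + b < 1/T` are in `L¹(e^{-H/T} dx)`;
* `sq_pairing_le_greenKubo_mul_leak` — **`γ (∫ J G dμ_T)² ≤ (N-1) T² D · T Σ_b ∫ (γ ∂_{p_b} G + w_b)² dμ_T`** for
  every DRESSED `G ∈ C²` (`X_H G = T(∂*_{p_0} w_L + ∂*_{p_{N-1}} w_R)`, `e^{θH}` class with first partials,
  `θ < 1/(2T)`). Proof: the smooth Kubo corrector `u` of the tree (`Corrector.corrector_smooth`: `L u = -J`,
  `|u| ≤ K e^{ϑH}`), the dressed pairing identity of part 1, Cauchy–Schwarz (through the discriminant), the tap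
  energy identity `γT Σ_b ‖∂_b u‖² = ⟨u, J⟩` (`Corrector.integral_mul_source_eq_dirichlet`) and the PROVED
  Kundu–Dhar–Narayan identity `⟨u, J⟩_{μ_T} = (N-1) T² D` (`openChainGreenKubo_holds`,
  `Corrector.greenKubo_of_openChainGreenKubo`, `pinnedChain_integral_corrector_mul_withDensity`).

This is the content of the route's `StaticKubo` + `ThomsonBound` in Green–Kubo form, obtained from the tree without
the (unvendored) pointwise gradient bound on the Poisson solution. No definitions; nothing here closes an item.
-/

noncomputable section

open MeasureTheory Filter Topology ProbabilityTheory
open scoped ContDiff NNReal ENNReal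
open Literature.MathematicalPhysics.KineticTheory.HeatConduction
open Summit.AtomisticToContinuum.FouriersLaw.Theorems.SuperadditiveResistance.DeviceLiouville
open Summit.AtomisticToContinuum.FouriersLaw.Theorems.SuperadditiveResistance.Kubo
open Summit.AtomisticToContinuum.FouriersLaw.Theorems.OddSectorIrreversibility.Corrector

namespace Summit.AtomisticToContinuum.FouriersLaw.Theorems.HiddenChargeMazur

variable {N : ℕ}

section Pinned

variable {ω₂ lam β γ : ℝ} (hω : 0 < ω₂) (hl : 0 ≤ lam) (hβ : 0 ≤ β) {T : ℝ} (hT : 0 < T)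
include hω hl hβ hT

/-- A product of two continuous observables of exponential classes `|f| ≤ A e^{aH}`, `|g| ≤ B e^{bH}` with
`a + b < 1/T` is integrable against `ρ = e^{-H/T}`. [folklore] -/
theorem integrable_mul_mul_gibbsDensity_of_abs_le_exp {f g : PhaseSpace N → ℝ}
    (hf : Continuous f) (hg : Continuous g) {A a B b : ℝ}
    (hfb : ∀ z, |f z| ≤ A * Real.exp (a * (pinnedChain ω₂ lam β γ).hamiltonian N z))
    (hgb : ∀ z, |g z| ≤ B * Real.exp (b * (pinnedChain ω₂ lam β γ).hamiltonian N z))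
    (hab : a + b < 1 / T) :
    Integrable fun x => f x * g x * (pinnedChain ω₂ lam β γ).gibbsDensity N T x := by
  set P := pinnedChain ω₂ lam β γ with hP
  have hρc : Continuous (P.gibbsDensity N T) := pinnedChain_continuous_gibbsDensity ω₂ lam β γ N T
  have hexp := pinnedChain_integrable_exp_mul_gibbsDensity hω hl hβ γ N hT hab
  refine (hexp.const_mul (A * B)).mono' ((hf.mul hg).mul hρc).aestronglyMeasurable
    (Eventually.of_forall fun z => ?_)
  have hρ0 : 0 < P.gibbsDensity N T z := P.gibbsDensity_pos N T z
  rw [Real.norm_eq_abs, abs_mul, abs_mul, abs_of_pos hρ0]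
  have hA : 0 ≤ A * Real.exp (a * P.hamiltonian N z) := (abs_nonneg _).trans (hfb z)
  have hB : 0 ≤ B * Real.exp (b * P.hamiltonian N z) := (abs_nonneg _).trans (hgb z)
  calc |f z| * |g z| * P.gibbsDensity N T z
      ≤ (A * Real.exp (a * P.hamiltonian N z)) * (B * Real.exp (b * P.hamiltonian N z)) *
          P.gibbsDensity N T z := by
        gcongr
        · exact hfb z
        · exact hgb z
    _ = A * B * (Real.exp ((a + b) * P.hamiltonian N z) * P.gibbsDensity N T z) := by
        rw [add_mul, Real.exp_add]; ring

end Pinned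

section Thomson

variable {ω₂ lam β γ : ℝ} (hω : 0 < ω₂) (hl : 0 < lam) (hβ : 0 < β) (hγ : 0 < γ) {T : ℝ} (hT : 0 < T)
include hω hl hβ hγ hT

/-- **The open-chain Mazur–Thomson bound for dressed test functions (fixed `N`).** For the pinned
anharmonic chain `P = pinnedChain ω₂ lam β γ` (all parameters `> 0`), `T > 0`, `N ≥ 1`, under weak-NESS
uniqueness and for any steady-state family, let `D` be the linear-response coefficient of the summed
current at `(N, T)`. Then for every DRESSED `G ∈ C²` — `{G, H}`-Liouville derivative
`X_H G = T(∂*_{p_0} w_L + ∂*_{p_{N-1}} w_R)` with `w_L, w_R ∈ C²`, all of `e^{θH}` class together with their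
first partials, `θ < 1/(2T)` — one has
`γ (∫ J G dμ_T)² ≤ (N-1) T² D · T Σ_b ∫ (γ ∂_{p_b} G + w_b)² dμ_T`.
Proof: with the smooth Kubo corrector `u` (`L u = -J`, tree: `corrector_smooth`),
`∫ J G = T Σ_b ⟨∂_b u, w_b + γ ∂_b G⟩` (`integral_source_mul_dressed`), Cauchy–Schwarz, the tap energy
identity `γ T Σ_b ‖∂_b u‖² = ⟨u, J⟩` and the Kundu–Dhar–Narayan identity `⟨u, J⟩_{μ_T} = (N-1)T² D`
(tree: `openChainGreenKubo_holds`, `pinnedChain_integral_corrector_mul_withDensity`).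
[cite: KunduDharNarayan2009, p. 3] [cite: KomorowskiLandimOlla2012, Ch. 2] -/
theorem sq_pairing_le_greenKubo_mul_leak {N : ℕ} (hN : 0 < N)
    (huniq : ∀ (N : ℕ) (T_L T_R : ℝ), 0 < T_L → 0 < T_R →
      ∀ μ ν : Measure (PhaseSpace N), (pinnedChain ω₂ lam β γ).IsSteadyState N T_L T_R μ →
        (pinnedChain ω₂ lam β γ).IsSteadyState N T_L T_R ν → μ = ν)
    (μf : (N : ℕ) → ℝ → ℝ → Measure (PhaseSpace N))
    (hμf : ∀ (N : ℕ) (T_L T_R : ℝ), 0 < T_L → 0 < T_R →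
      (pinnedChain ω₂ lam β γ).IsSteadyState N T_L T_R (μf N T_L T_R))
    {D : ℝ} (hD : Tendsto (fun δ : ℝ => (pinnedChain ω₂ lam β γ).totalCurrent (μf N (T + δ / 2) (T - δ / 2)) / δ)
      (𝓝[≠] 0) (𝓝 D))
    {G wL wR : PhaseSpace N → ℝ} (hG : ContDiff ℝ 2 G) (hwL : ContDiff ℝ 2 wL) (hwR : ContDiff ℝ 2 wR)
    {C θ : ℝ} (hθ : θ < 1 / (2 * T))
    (hgrowth : ∀ (z : PhaseSpace N) (i : Fin N), |G z| + |wL z| + |wR z| + |partialP i G z| + |partialQ i G z| +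
      |partialP i wL z| + |partialQ i wL z| + |partialP i wR z| + |partialQ i wR z| ≤
        C * Real.exp (θ * (pinnedChain ω₂ lam β γ).hamiltonian N z))
    (hdress : ∀ z : PhaseSpace N, (∑ x : Fin N, (partialP x ((pinnedChain ω₂ lam β γ).hamiltonian N) z *
        partialQ x G z - partialQ x ((pinnedChain ω₂ lam β γ).hamiltonian N) z * partialP x G z)) =
      T * ∑ i : Fin N, ((if i.val = 0 then -partialP i wL z + z.2 i / T * wL z else 0) +
        (if i.val = N - 1 then -partialP i wR z + z.2 i / T * wR z else 0))) :
    γ * (∫ z, (∑ i : Fin N, (pinnedChain ω₂ lam β γ).bondCurrent N i z) * G z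
        ∂((pinnedChain ω₂ lam β γ).gibbsMeasure N T)) ^ 2 ≤
      ((N : ℝ) - 1) * T ^ 2 * D *
        (T * ∑ i : Fin N, ((if i.val = 0 then ∫ z, (γ * partialP i G z + wL z) ^ 2
            ∂((pinnedChain ω₂ lam β γ).gibbsMeasure N T) else 0) +
          (if i.val = N - 1 then ∫ z, (γ * partialP i G z + wR z) ^ 2
            ∂((pinnedChain ω₂ lam β γ).gibbsMeasure N T) else 0))) := by
  set P := pinnedChain ω₂ lam β γ with hP
  set π := P.gibbsMeasure N T with hπ
  set ρ := P.gibbsDensity N T with hρ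
  set J : PhaseSpace N → ℝ := fun z => ∑ i : Fin N, P.bondCurrent N i z with hJ
  set μT : Measure (PhaseSpace N) := (volume : Measure (PhaseSpace N)).withDensity
    (fun x => ENNReal.ofReal (Real.exp (-(P.hamiltonian N x) / T))) with hμT
  -- bath sites
  set b₀ : Fin N := ⟨0, hN⟩ with hb₀def
  set b₁ : Fin N := ⟨N - 1, by omega⟩ with hb₁def
  have hb₀ : b₀.val = 0 := rfl
  have hb₁ : b₁.val = N - 1 := rfl
  have hB₀ : 0 < OscillatorChain.bathWeight N b₀ := by
    unfold OscillatorChain.bathWeight; rw [if_pos hb₀]; split_ifs <;> norm_num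
  have hB₁ : 0 < OscillatorChain.bathWeight N b₁ := by
    unfold OscillatorChain.bathWeight; rw [if_pos hb₁]; split_ifs <;> norm_num
  -- exponents
  have hϑ : 0 < 1 / (4 * T) := by positivity
  have h1ϑ : 1 / (4 * T) < 1 / T := by
    rw [div_lt_div_iff₀ (by positivity) hT]; nlinarith
  have h2ϑ : 2 * (1 / (4 * T)) < 1 / T := by
    rw [show 2 * (1 / (4 * T)) = 1 / (2 * T) by field_simp; ring, div_lt_div_iff₀ (by positivity) hT]
    nlinarith
  have h2θ : 2 * θ < 1 / T := by
    have h := hθ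
    rw [lt_div_iff₀ (by positivity)] at h
    rw [lt_div_iff₀ hT]; linarith
  have hθϑ : 1 / (4 * T) + θ < 1 / T := by
    have h := hθ
    rw [lt_div_iff₀ (by positivity)] at h
    have h1 : (1 / (4 * T) + θ) * T = 1 / 4 + θ * T := by field_simp
    rw [lt_div_iff₀ hT, h1]; linarith
  -- standard facts
  have hU : Continuous P.U := (pinnedChain_contDiff_U ω₂ lam β γ (n := 0)).continuous
  have hV : Continuous P.V := (pinnedChain_contDiff_V ω₂ lam β γ (n := 0)).continuous
  have hJc : Continuous J := continuous_totalBondCurrent ω₂ lam β γ N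
  obtain ⟨M, -, hJM⟩ := abs_totalBondCurrent_le_exp hω.le hl.le hβ.le γ N hϑ
  have hJ2 : MemLp J 2 π := memLp_two_of_abs_le_exp hω hl.le hβ.le hT γ hJc h2ϑ hJM
  -- the corrector
  obtain ⟨u, hus, hae, hpde, hgrowthU⟩ := corrector_smooth hω hl hβ hγ hT hN
  have hu2 : ContDiff ℝ 2 u := hus.of_le (by norm_cast)
  have hu1 : ContDiff ℝ 1 u := hus.of_le (by norm_cast)
  have huC : Continuous u := hus.continuous
  obtain ⟨K₁, -, huK⟩ := hgrowthU (1 / (4 * T)) hϑ h1ϑ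
  have hu2g : MemLp u 2 π := memLp_two_of_abs_le_exp hω hl.le hβ.le hT γ huC h2ϑ huK
  obtain ⟨K, c, -, -, -, -, -, -, -, hw2, hL2, -⟩ := corrector_exists hω hl hβ hγ hT hN hϑ h2ϑ
    (fun s z => ∫ y, J y ∂(P.transitionKernel N T T s.toNNReal z)) rfl
    (fun z => ∫ s in Set.Ioi (0 : ℝ), ∫ y, J y ∂(P.transitionKernel N T T s.toNNReal z)) rfl
  have haeμ : (fun x => ∫ t in Set.Ioi (0 : ℝ), ∫ y, J y ∂(P.transitionKernel N T T t.toNNReal x)) =ᵐ[μT] u :=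
    (withDensity_absolutelyContinuous _ _).ae_eq hae
  -- the Kundu–Dhar–Narayan identity `(N-1) T² D = ∫₀^∞ ⟨J, P_t J⟩` and `⟨w, J⟩_{μT} = Z · ∫₀^∞ ⟨J, P_t J⟩`
  obtain ⟨hcorr, hKDN⟩ := greenKubo_of_openChainGreenKubo openChainGreenKubo_holds ω₂ lam β γ hω hl hβ hγ
    huniq μf hμf T hT N D hD
  obtain ⟨-, hwJ⟩ := pinnedChain_integral_corrector_mul_withDensity hω hl.le hβ hγ hN hT hw2 hL2 hcorr
  set GK := ∫ t in Set.Ioi (0 : ℝ), ∫ z, J z * (∫ y, J y ∂(P.transitionKernel N T T t.toNNReal z)) ∂π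
    with hGK
  set Zr := ∫ x, ρ x with hZr
  have hint : Integrable (P.gibbsDensity N T) := pinnedChain_integrable_gibbsDensity hω hl.le hβ.le γ N hT
  have hZpos : 0 < Zr := integral_exp_pos hint
  have hZ0 : Zr ≠ 0 := hZpos.ne'
  -- `⟨u, J⟩_ρ = Z · GK`
  have huJμ : ∫ x, u x * J x ∂μT = (∫ x : PhaseSpace N, Real.exp (-(P.hamiltonian N x) / T)) * GK := by
    rw [← hwJ]
    refine integral_congr_ae ?_
    filter_upwards [haeμ] with x hx
    rw [← hx]
  have hZexp : Zr = ∫ x : PhaseSpace N, Real.exp (-(P.hamiltonian N x) / T) := rfl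
  have huJρ : ∫ x, u x * J x * ρ x = Zr * GK := by
    have h1 : ∫ x, u x * J x ∂μT = ∫ x, u x * J x * ρ x :=
      integral_withDensity_gibbs P hU hV N T (fun x => u x * J x)
    rw [← h1, huJμ, hZexp]
  -- the tap energy identity `γ T (‖∂₀u‖² + ‖∂₁u‖²) = ⟨u, J⟩_ρ`
  have htap := integral_mul_source_eq_dirichlet hω hl.le hβ.le hγ hT hu2 hu2g hJc hJ2 hpde
  rw [sum_bathWeight_mul _ hb₀ hb₁] at htap
  -- growth of the dressed test functions
  have hGb : ∀ z, |G z| ≤ C * Real.exp (θ * P.hamiltonian N z) := fun z => by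
    have h := hgrowth z b₀
    linarith [abs_nonneg (wL z), abs_nonneg (wR z), abs_nonneg (partialP b₀ G z), abs_nonneg (partialQ b₀ G z),
      abs_nonneg (partialP b₀ wL z), abs_nonneg (partialQ b₀ wL z), abs_nonneg (partialP b₀ wR z),
      abs_nonneg (partialQ b₀ wR z)]
  have hwLb : ∀ z, |wL z| ≤ C * Real.exp (θ * P.hamiltonian N z) := fun z => by
    have h := hgrowth z b₀
    linarith [abs_nonneg (G z), abs_nonneg (wR z), abs_nonneg (partialP b₀ G z), abs_nonneg (partialQ b₀ G z),
      abs_nonneg (partialP b₀ wL z), abs_nonneg (partialQ b₀ wL z), abs_nonneg (partialP b₀ wR z),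
      abs_nonneg (partialQ b₀ wR z)]
  have hwRb : ∀ z, |wR z| ≤ C * Real.exp (θ * P.hamiltonian N z) := fun z => by
    have h := hgrowth z b₀
    linarith [abs_nonneg (G z), abs_nonneg (wL z), abs_nonneg (partialP b₀ G z), abs_nonneg (partialQ b₀ G z),
      abs_nonneg (partialP b₀ wL z), abs_nonneg (partialQ b₀ wL z), abs_nonneg (partialP b₀ wR z),
      abs_nonneg (partialQ b₀ wR z)]
  have hdGb : ∀ (i : Fin N) (z : PhaseSpace N), |partialP i G z| ≤ C * Real.exp (θ * P.hamiltonian N z) :=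
    fun i z => by
    have h := hgrowth z i
    linarith [abs_nonneg (G z), abs_nonneg (wL z), abs_nonneg (wR z), abs_nonneg (partialQ i G z),
      abs_nonneg (partialP i wL z), abs_nonneg (partialQ i wL z), abs_nonneg (partialP i wR z),
      abs_nonneg (partialQ i wR z)]
  -- `L²(π)` memberships
  have hG1 : ContDiff ℝ 1 G := hG.of_le (by norm_cast)
  have hwL1 : ContDiff ℝ 1 wL := hwL.of_le (by norm_cast)
  have hwR1 : ContDiff ℝ 1 wR := hwR.of_le (by norm_cast)
  have hGC : Continuous G := hG.continuous
  have hwLC : Continuous wL := hwL.continuous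
  have hwRC : Continuous wR := hwR.continuous
  have hdGC : ∀ i, Continuous (partialP i G) := fun i => continuous_partialP hG1 one_ne_zero i
  have hduC : ∀ i, Continuous (partialP i u) := fun i => continuous_partialP hu1 one_ne_zero i
  have hG2 : MemLp G 2 π := memLp_two_of_abs_le_exp hω hl.le hβ.le hT γ hGC h2θ hGb
  have hwL2 : MemLp wL 2 π := memLp_two_of_abs_le_exp hω hl.le hβ.le hT γ hwLC h2θ hwLb
  have hwR2 : MemLp wR 2 π := memLp_two_of_abs_le_exp hω hl.le hβ.le hT γ hwRC h2θ hwRb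
  have hdG2 : ∀ i, MemLp (partialP i G) 2 π := fun i =>
    memLp_two_of_abs_le_exp hω hl.le hβ.le hT γ (hdGC i) h2θ (hdGb i)
  have hdu2 : ∀ {i : Fin N}, 0 < OscillatorChain.bathWeight N i → MemLp (partialP i u) 2 π := fun hi =>
    memLp_partialP_of_poisson hω hl.le hβ.le hγ hT hu2 hu2g hJ2 hpde hi
  -- integrability against `ρ`
  have ikG : Integrable fun x => J x * G x * ρ x :=
    integrable_mul_mul_gibbsDensity_of_abs_le_exp hω hl.le hβ.le hT hJc hGC hJM hGb hθϑ
  have i0w : Integrable fun x => partialP b₀ u x * wL x * ρ x :=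
    integrable_mul_mul_gibbsDensity hω hl.le hβ.le γ N hT (hdu2 hB₀) hwL2
  have i1w : Integrable fun x => partialP b₁ u x * wR x * ρ x :=
    integrable_mul_mul_gibbsDensity hω hl.le hβ.le γ N hT (hdu2 hB₁) hwR2
  have i0u : Integrable fun x => u x * wL x * ρ x :=
    integrable_mul_mul_gibbsDensity_of_abs_le_exp hω hl.le hβ.le hT huC hwLC huK hwLb hθϑ
  have i1u : Integrable fun x => u x * wR x * ρ x :=
    integrable_mul_mul_gibbsDensity_of_abs_le_exp hω hl.le hβ.le hT huC hwRC huK hwRb hθϑ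
  have i0G : Integrable fun x => partialP b₀ G x * partialP b₀ u x * ρ x :=
    integrable_mul_mul_gibbsDensity hω hl.le hβ.le γ N hT (hdG2 b₀) (hdu2 hB₀)
  have i1G : Integrable fun x => partialP b₁ G x * partialP b₁ u x * ρ x :=
    integrable_mul_mul_gibbsDensity hω hl.le hβ.le γ N hT (hdG2 b₁) (hdu2 hB₁)
  have i0Gu : Integrable fun x => G x * partialP b₀ u x * ρ x :=
    integrable_mul_mul_gibbsDensity hω hl.le hβ.le γ N hT hG2 (hdu2 hB₀)
  have i1Gu : Integrable fun x => G x * partialP b₁ u x * ρ x :=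
    integrable_mul_mul_gibbsDensity hω hl.le hβ.le γ N hT hG2 (hdu2 hB₁)
  -- the dressing in Liouville-operator form
  have hXG : ∀ x, liouvilleOp P N G x =
      T * ((-partialP b₀ wL x + x.2 b₀ / T * wL x) + (-partialP b₁ wR x + x.2 b₁ / T * wR x)) := by
    intro x
    have h := hdress x
    rw [sum_ite_bath (fun i => -partialP i wL x + x.2 i / T * wL x)
      (fun i => -partialP i wR x + x.2 i / T * wR x) hb₀ hb₁] at h
    rw [← h]
    unfold liouvilleOp
    exact Finset.sum_congr rfl fun i _ => by rw [P.partialP_hamiltonian]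
  -- the dressed pairing identity
  have hId := integral_source_mul_dressed hω hl.le hβ.le hT hu2 hJc hG hwL1 hwR1 hpde hb₀ hb₁ hXG ikG i0w i1w
    i0u i1u i0G i1G i0Gu i1Gu
  -- the dressed fluxes `v_b = γ ∂_b G + w_b`
  set v₀ : PhaseSpace N → ℝ := fun x => γ * partialP b₀ G x + wL x with hv₀
  set v₁ : PhaseSpace N → ℝ := fun x => γ * partialP b₁ G x + wR x with hv₁
  have hv₀2 : MemLp v₀ 2 π := ((hdG2 b₀).const_mul γ).add hwL2
  have hv₁2 : MemLp v₁ 2 π := ((hdG2 b₁).const_mul γ).add hwR2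
  set a₀ := ∫ x, partialP b₀ u x ^ 2 * ρ x with ha₀
  set a₁ := ∫ x, partialP b₁ u x ^ 2 * ρ x with ha₁
  set e₀ := ∫ x, v₀ x ^ 2 * ρ x with he₀
  set e₁ := ∫ x, v₁ x ^ 2 * ρ x with he₁
  set X₀ := ∫ x, partialP b₀ u x * v₀ x * ρ x with hX₀
  set X₁ := ∫ x, partialP b₁ u x * v₁ x * ρ x with hX₁
  have iuu0 : Integrable fun x => partialP b₀ u x ^ 2 * ρ x :=
    integrable_sq_mul_gibbsDensity hω hl.le hβ.le γ N hT (hdu2 hB₀)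
  have iuu1 : Integrable fun x => partialP b₁ u x ^ 2 * ρ x :=
    integrable_sq_mul_gibbsDensity hω hl.le hβ.le γ N hT (hdu2 hB₁)
  have ivv0 : Integrable fun x => v₀ x ^ 2 * ρ x := integrable_sq_mul_gibbsDensity hω hl.le hβ.le γ N hT hv₀2
  have ivv1 : Integrable fun x => v₁ x ^ 2 * ρ x := integrable_sq_mul_gibbsDensity hω hl.le hβ.le γ N hT hv₁2
  have iuv0 : Integrable fun x => partialP b₀ u x * v₀ x * ρ x :=
    integrable_mul_mul_gibbsDensity hω hl.le hβ.le γ N hT (hdu2 hB₀) hv₀2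
  have iuv1 : Integrable fun x => partialP b₁ u x * v₁ x * ρ x :=
    integrable_mul_mul_gibbsDensity hω hl.le hβ.le γ N hT (hdu2 hB₁) hv₁2
  -- `∫ J G ρ = T (X₀ + X₁)`
  have hX₀' : X₀ = γ * (∫ x, partialP b₀ G x * partialP b₀ u x * ρ x) + ∫ x, partialP b₀ u x * wL x * ρ x := by
    have e : (fun x => partialP b₀ u x * v₀ x * ρ x) = fun x =>
        γ * (partialP b₀ G x * partialP b₀ u x * ρ x) + partialP b₀ u x * wL x * ρ x := by
      funext x; simp only [hv₀]; ring
    have i' : Integrable fun x => γ * (partialP b₀ G x * partialP b₀ u x * ρ x) := i0G.const_mul γ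
    rw [hX₀, e, integral_add i' i0w, integral_const_mul]
  have hX₁' : X₁ = γ * (∫ x, partialP b₁ G x * partialP b₁ u x * ρ x) + ∫ x, partialP b₁ u x * wR x * ρ x := by
    have e : (fun x => partialP b₁ u x * v₁ x * ρ x) = fun x =>
        γ * (partialP b₁ G x * partialP b₁ u x * ρ x) + partialP b₁ u x * wR x * ρ x := by
      funext x; simp only [hv₁]; ring
    have i' : Integrable fun x => γ * (partialP b₁ G x * partialP b₁ u x * ρ x) := i1G.const_mul γ
    rw [hX₁, e, integral_add i' i1w, integral_const_mul]
  have hJGρ : ∫ x, J x * G x * ρ x = T * (X₀ + X₁) := by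
    rw [hId, hX₀', hX₁']; ring
  -- Cauchy–Schwarz through the discriminant: `(X₀ + X₁)² ≤ (a₀ + a₁)(e₀ + e₁)`
  clear_value X₀ X₁ a₀ a₁ e₀ e₁
  have hquad : ∀ t : ℝ, 0 ≤ (a₀ + a₁) * (t * t) + (-(2 * (X₀ + X₁))) * t + (e₀ + e₁) := by
    intro t
    have hnn : 0 ≤ ∫ x, ((t * partialP b₀ u x - v₀ x) ^ 2 + (t * partialP b₁ u x - v₁ x) ^ 2) * ρ x :=
      integral_nonneg fun x => mul_nonneg (add_nonneg (sq_nonneg _) (sq_nonneg _)) (P.gibbsDensity_pos N T x).le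
    have e : (fun x => ((t * partialP b₀ u x - v₀ x) ^ 2 + (t * partialP b₁ u x - v₁ x) ^ 2) * ρ x) = fun x =>
        (t ^ 2 * (partialP b₀ u x ^ 2 * ρ x) + t ^ 2 * (partialP b₁ u x ^ 2 * ρ x)) -
          (2 * t * (partialP b₀ u x * v₀ x * ρ x) + 2 * t * (partialP b₁ u x * v₁ x * ρ x)) +
          (v₀ x ^ 2 * ρ x + v₁ x ^ 2 * ρ x) := by
      funext x; ring
    have j1 : Integrable fun x => t ^ 2 * (partialP b₀ u x ^ 2 * ρ x) + t ^ 2 * (partialP b₁ u x ^ 2 * ρ x) :=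
      (iuu0.const_mul _).add (iuu1.const_mul _)
    have j2 : Integrable fun x => 2 * t * (partialP b₀ u x * v₀ x * ρ x) + 2 * t * (partialP b₁ u x * v₁ x * ρ x) :=
      (iuv0.const_mul _).add (iuv1.const_mul _)
    have j3 : Integrable fun x => v₀ x ^ 2 * ρ x + v₁ x ^ 2 * ρ x := ivv0.add ivv1
    have j12 : Integrable fun x => (t ^ 2 * (partialP b₀ u x ^ 2 * ρ x) + t ^ 2 * (partialP b₁ u x ^ 2 * ρ x)) -
        (2 * t * (partialP b₀ u x * v₀ x * ρ x) + 2 * t * (partialP b₁ u x * v₁ x * ρ x)) := j1.sub j2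
    have i1' : Integrable fun x => t ^ 2 * (partialP b₀ u x ^ 2 * ρ x) := iuu0.const_mul _
    have i2' : Integrable fun x => t ^ 2 * (partialP b₁ u x ^ 2 * ρ x) := iuu1.const_mul _
    have i3' : Integrable fun x => 2 * t * (partialP b₀ u x * v₀ x * ρ x) := iuv0.const_mul _
    have i4' : Integrable fun x => 2 * t * (partialP b₁ u x * v₁ x * ρ x) := iuv1.const_mul _
    rw [e, integral_add j12 j3, integral_sub j1 j2, integral_add i1' i2', integral_add i3' i4',
      integral_add ivv0 ivv1, integral_const_mul, integral_const_mul, integral_const_mul, integral_const_mul] at hnn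
    rw [← ha₀, ← ha₁, ← he₀, ← he₁, ← hX₀, ← hX₁] at hnn
    have e2 : (a₀ + a₁) * (t * t) + (-(2 * (X₀ + X₁))) * t + (e₀ + e₁) =
        t ^ 2 * a₀ + t ^ 2 * a₁ - (2 * t * X₀ + 2 * t * X₁) + (e₀ + e₁) := by ring
    rw [e2]; exact hnn
  have hdisc := discrim_le_zero hquad
  rw [discrim] at hdisc
  have hsq : (-(2 * (X₀ + X₁))) ^ 2 = 4 * (X₀ + X₁) ^ 2 := by ring
  rw [hsq] at hdisc
  have hCS : (X₀ + X₁) ^ 2 ≤ (a₀ + a₁) * (e₀ + e₁) := by linarith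
  -- the tap identity and the KDN identity: `γ T (a₀ + a₁) = Z · GK = Z · (N-1) T² D`
  have key : γ * T * (a₀ + a₁) = Zr * GK := by rw [← huJρ, htap]
  -- normalised integrals
  have hIπ : ∫ z, J z * G z ∂π = Zr⁻¹ * ∫ x, J x * G x * ρ x := P.integral_gibbsMeasure (fun z => J z * G z)
  have he₀π : ∫ z, v₀ z ^ 2 ∂π = Zr⁻¹ * e₀ := by rw [he₀]; exact P.integral_gibbsMeasure (fun z => v₀ z ^ 2)
  have he₁π : ∫ z, v₁ z ^ 2 ∂π = Zr⁻¹ * e₁ := by rw [he₁]; exact P.integral_gibbsMeasure (fun z => v₁ z ^ 2)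
  clear_value Zr GK
  -- conclusion
  rw [sum_ite_bath (fun i => ∫ z, (γ * partialP i G z + wL z) ^ 2 ∂π)
    (fun i => ∫ z, (γ * partialP i G z + wR z) ^ 2 ∂π) hb₀ hb₁]
  change γ * (∫ z, J z * G z ∂π) ^ 2 ≤ ((N : ℝ) - 1) * T ^ 2 * D * (T * ((∫ z, v₀ z ^ 2 ∂π) + ∫ z, v₁ z ^ 2 ∂π))
  rw [hIπ, he₀π, he₁π, hJGρ, hKDN]
  have hTA : 0 ≤ γ * T * T * Zr⁻¹ ^ 2 := by positivity
  calc γ * (Zr⁻¹ * (T * (X₀ + X₁))) ^ 2 = (γ * T * T * Zr⁻¹ ^ 2) * (X₀ + X₁) ^ 2 := by ring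
    _ ≤ (γ * T * T * Zr⁻¹ ^ 2) * ((a₀ + a₁) * (e₀ + e₁)) := mul_le_mul_of_nonneg_left hCS hTA
    _ = (γ * T * (a₀ + a₁)) * (T * Zr⁻¹ ^ 2 * (e₀ + e₁)) := by ring
    _ = (Zr * GK) * (T * Zr⁻¹ ^ 2 * (e₀ + e₁)) := by rw [key]
    _ = GK * (T * (Zr⁻¹ * e₀ + Zr⁻¹ * e₁)) := by field_simp

end Thomson

end Summit.AtomisticToContinuum.FouriersLaw.Theorems.HiddenChargeMazur

end
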